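import Literature.NumberTheory.EllipticCurves.IwasawaAlgebraTwoVarGeneratorChange
import Summits.BirchSwinnertonDyer.Rank1Residual.X11b.HalvesReceptacle
import HarnessLib

/-!
# Base change of the group-like frame substitution: `map f ∘ φ_A = φ_A ∘ map f` (helper on the rational wall
# `RationalSplitIMCInclusionAtThree`, item stmt-BirchSwinnertonDyer-24207, line `ratwall_thin_comb` v7; cell `pub/bsd-wall`,
# LEAD `cruxlead-24207` g5; `--supports stmt-BirchSwinnertonDyer-24207`)

WHY THIS FILE. The K4 stub of the line (`stub_charIdealSymmUpTo2`, v7) asks for the algebraic functional equation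
`φ_{A_τ} g′ ∼ g′` of the characteristic element READ IN the receptacle `R₀⟦T₂⟧⟦T₁⟧` (`R₀ = unrIntegers 3`,
`g′ = map (map toUnr) g`), because that is where the toric function and the rigidity step live; but a typed source (Hao–Lim 2026 (c))
would deliver it over `Λ₂ = ℤ₃⟦T₂⟧⟦T₁⟧`, the coefficient ring of `X_Gr`. This file proves that the frame substitution
`φ_A = IwasawaAlgebra₂.frameSubst 𝒪 A` commutes with base change along any `ℤ_p`-algebra homomorphism `f : 𝒪 →ₐ[ℤ_p] 𝒪′`
(`map_map_frameSubst`), in particular along `toUnr p : ℤ_p → R₀` (`map_map_frameSubst_toUnr`), so that a symmetry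
`φ_A g ∼ g` over `ℤ_p` transports to `φ_A g′ ∼ g′` over `R₀` (`associated_frameSubst_map_toUnr`).

CONTENTS (theorems only; no definition, no instance, no notation, no `sorry`; nothing about elliptic curves):
`nestedPowerSeriesEquiv_map_map` / `nestedPowerSeriesEquiv_symm_map` (the nested ↔ two-variable dictionary commutes with `map`),
`map_onePlusXPow_algHom`, `map_frameImages`, `map_frameSubstMv`, **`map_map_frameSubst`**, `map_map_frameSubst_toUnr`,
`associated_frameSubst_map_toUnr`.

HONEST FRAMING. Algebra only; no functional equation is proved; BSD is not proved by any of this; 24207 stays OPEN.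
References: Neukirch–Schmidt–Wingberg (5.3.5) [cite: NeukirchSchmidtWingberg2008, (5.3.5)]; Washington §13.2
[cite: Washington1997, §13.2]; Bourbaki, *Algebra* II, Ch. IV §4 (formal power series, substitution and change of ring)
[cite: BourbakiAlgebraII2003, Ch. IV §4].
-/

set_option linter.dupNamespace false
set_option autoImplicit false

noncomputable section

open scoped MatrixGroups
open Literature.NumberTheory.EllipticCurves Literature.NumberTheory.IwasawaTheory

namespace Summit.BirchSwinnertonDyer.BirchSwinnertonDyer.Theorems.UniversalToricDescentThinComb.FrameSubstMap

/-! ## §1 The nested dictionary commutes with base change -/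

section Nested

variable {𝒪 𝒪' : Type*} [CommRing 𝒪] [CommRing 𝒪'] (f : 𝒪 →+* 𝒪')

/-- `nested (map (map f) F) = map f (nested F)`: the dictionary `𝒪⟦T₂⟧⟦T₁⟧ ≅ 𝒪⟦T₁, T₂⟧` commutes with base change
(coefficientwise). [cite: BourbakiAlgebraII2003, Ch. IV §4] -/
theorem nestedPowerSeriesEquiv_map_map (F : PowerSeries (PowerSeries 𝒪)) :
    nestedPowerSeriesEquiv (PowerSeries.map (PowerSeries.map f) F) =
      MvPowerSeries.map f (nestedPowerSeriesEquiv F) := by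
  ext d
  rw [coeff_nestedPowerSeriesEquiv, MvPowerSeries.coeff_map, coeff_nestedPowerSeriesEquiv,
    PowerSeries.coeff_map, PowerSeries.coeff_map]

/-- The inverse dictionary commutes with base change. [cite: BourbakiAlgebraII2003, Ch. IV §4] -/
theorem nestedPowerSeriesEquiv_symm_map (G : MvPowerSeries (Fin 2) 𝒪) :
    (nestedPowerSeriesEquiv (R := 𝒪')).symm (MvPowerSeries.map f G) =
      PowerSeries.map (PowerSeries.map f) ((nestedPowerSeriesEquiv (R := 𝒪)).symm G) := by
  apply (nestedPowerSeriesEquiv (R := 𝒪')).injective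
  rw [RingEquiv.apply_symm_apply, nestedPowerSeriesEquiv_map_map, RingEquiv.apply_symm_apply]

end Nested

/-! ## §2 `φ_A` commutes with base change along `ℤ_p`-algebra homomorphisms -/

section BaseChange

variable {p : ℕ} [Fact p.Prime] {𝒪 𝒪' : Type*} [CommRing 𝒪] [CommRing 𝒪'] [Algebra ℤ_[p] 𝒪] [Algebra ℤ_[p] 𝒪']
  (f : 𝒪 →ₐ[ℤ_[p]] 𝒪')

/-- `map f ((1+T_i)^x over 𝒪) = (1+T_i)^x over 𝒪′` for a `ℤ_p`-algebra map `f` (both are base changes of the series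
over `ℤ_p`). [cite: NeukirchSchmidtWingberg2008, (5.3.5)] -/
theorem map_onePlusXPow_algHom (i : Fin 2) (x : ℤ_[p]) :
    MvPowerSeries.map (f : 𝒪 →+* 𝒪') (IwasawaAlgebra₂.onePlusXPow 𝒪 i x) = IwasawaAlgebra₂.onePlusXPow 𝒪' i x := by
  rw [← IwasawaAlgebra₂.map_onePlusXPow 𝒪 i x, ← IwasawaAlgebra₂.map_onePlusXPow 𝒪' i x, MvPowerSeries.map_map,
    f.comp_algebraMap]

/-- `map f` carries the frame images of `A` over `𝒪` to those over `𝒪′`. [cite: NeukirchSchmidtWingberg2008, (5.3.5)] -/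
theorem map_frameImages (A : Matrix (Fin 2) (Fin 2) ℤ_[p]) (j : Fin 2) :
    MvPowerSeries.map (f : 𝒪 →+* 𝒪') (IwasawaAlgebra₂.frameImages 𝒪 A j) = IwasawaAlgebra₂.frameImages 𝒪' A j := by
  rw [IwasawaAlgebra₂.frameImages_def, IwasawaAlgebra₂.frameImages_def, map_sub, map_one,
    IwasawaAlgebra₂.frameMonomial_def, IwasawaAlgebra₂.frameMonomial_def, map_mul, map_onePlusXPow_algHom,
    map_onePlusXPow_algHom]

/-- The two-variable frame substitution commutes with base change: `map f (φ_A G) = φ_A (map f G)` on `𝒪⟦T₁, T₂⟧`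
(Mathlib `MvPowerSeries.map_subst`). [cite: BourbakiAlgebraII2003, Ch. IV §4] [cite: NeukirchSchmidtWingberg2008, (5.3.5)] -/
theorem map_frameSubstMv (A : Matrix (Fin 2) (Fin 2) ℤ_[p]) (G : MvPowerSeries (Fin 2) 𝒪) :
    MvPowerSeries.map (f : 𝒪 →+* 𝒪') (IwasawaAlgebra₂.frameSubstMv 𝒪 A G) =
      IwasawaAlgebra₂.frameSubstMv 𝒪' A (MvPowerSeries.map (f : 𝒪 →+* 𝒪') G) := by
  rw [IwasawaAlgebra₂.frameSubstMv_apply, IwasawaAlgebra₂.frameSubstMv_apply,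
    MvPowerSeries.map_subst (IwasawaAlgebra₂.hasSubst_frameImages 𝒪 A)]
  congr 1
  funext j
  exact map_frameImages f A j

/-- **`map (map f) (φ_A F) = φ_A (map (map f) F)`** on the nested model `𝒪⟦T₂⟧⟦T₁⟧`, for every `A ∈ GL₂(ℤ_p)` and every
`ℤ_p`-algebra homomorphism `f : 𝒪 → 𝒪′`. [cite: BourbakiAlgebraII2003, Ch. IV §4] [cite: NeukirchSchmidtWingberg2008, (5.3.5)] -/
theorem map_map_frameSubst (A : GL (Fin 2) ℤ_[p]) (F : PowerSeries (PowerSeries 𝒪)) :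
    PowerSeries.map (PowerSeries.map (f : 𝒪 →+* 𝒪')) (IwasawaAlgebra₂.frameSubst 𝒪 A F) =
      IwasawaAlgebra₂.frameSubst 𝒪' A (PowerSeries.map (PowerSeries.map (f : 𝒪 →+* 𝒪')) F) := by
  rw [IwasawaAlgebra₂.frameSubst_apply, IwasawaAlgebra₂.frameSubst_apply, IwasawaAlgebra₂.frameSubstRingHom_apply,
    IwasawaAlgebra₂.frameSubstRingHom_apply, ← nestedPowerSeriesEquiv_symm_map, map_frameSubstMv,
    nestedPowerSeriesEquiv_map_map]

end BaseChange

/-! ## §3 The receptacle: `ℤ_p⟦T₂⟧⟦T₁⟧ → R₀⟦T₂⟧⟦T₁⟧` along `toUnr p` -/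

section Unr

open Summit.BirchSwinnertonDyer.Rank1Residual.X11b.Halves

variable (p : ℕ) [Fact p.Prime]

/-- **`map (map toUnr) (φ_A g) = φ_A (map (map toUnr) g)`**: the frame substitution over `ℤ_p` and over `R₀ = unrIntegers p`
(a `ℤ_p`-algebra through `toUnr p`) are compatible with the coefficient map `Λ₂ → R₀⟦T₂⟧⟦T₁⟧`.
[cite: NeukirchSchmidtWingberg2008, (5.3.5)] [cite: Washington1997, §13.2] -/
theorem map_map_frameSubst_toUnr (A : GL (Fin 2) ℤ_[p]) (g : PowerSeries (PowerSeries ℤ_[p])) :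
    letI : Algebra ℤ_[p] (unrIntegers p) := (toUnr p).toAlgebra
    PowerSeries.map (PowerSeries.map (toUnr p)) (IwasawaAlgebra₂.frameSubst ℤ_[p] A g) =
      IwasawaAlgebra₂.frameSubst (unrIntegers p) A (PowerSeries.map (PowerSeries.map (toUnr p)) g) := by
  letI : Algebra ℤ_[p] (unrIntegers p) := (toUnr p).toAlgebra
  exact map_map_frameSubst (Algebra.ofId ℤ_[p] (unrIntegers p)) A g

/-- **Transport of the algebraic functional equation to the receptacle**: if `φ_A g ∼ g` in `Λ₂ = ℤ_p⟦T₂⟧⟦T₁⟧` then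
`φ_A g′ ∼ g′` in `R₀⟦T₂⟧⟦T₁⟧` for `g′ = map (map toUnr) g` — the form in which the line's v7 stub `stub_charIdealSymmUpTo2` consumes K4.
[cite: NeukirchSchmidtWingberg2008, (5.3.5)] [cite: Washington1997, §13.2] -/
theorem associated_frameSubst_map_toUnr (A : GL (Fin 2) ℤ_[p]) {g : PowerSeries (PowerSeries ℤ_[p])}
    (h : Associated (IwasawaAlgebra₂.frameSubst ℤ_[p] A g) g) :
    letI : Algebra ℤ_[p] (unrIntegers p) := (toUnr p).toAlgebra
    Associated (IwasawaAlgebra₂.frameSubst (unrIntegers p) A (PowerSeries.map (PowerSeries.map (toUnr p)) g))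
      (PowerSeries.map (PowerSeries.map (toUnr p)) g) := by
  letI : Algebra ℤ_[p] (unrIntegers p) := (toUnr p).toAlgebra
  rw [← map_map_frameSubst_toUnr]
  exact h.map (PowerSeries.map (PowerSeries.map (toUnr p)))

end Unr

end Summit.BirchSwinnertonDyer.BirchSwinnertonDyer.Theorems.UniversalToricDescentThinComb.FrameSubstMap

end
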